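import Mathlib

/-!
# STUB-IDEAS k1-g37 — «PRIM₂ IS FINITARY»: weakest sufficient / strongest provable forms of
# R218 «PRIM₂» (bounded `D`-primitive of the relative tilde family at `2`)

Sketch for `stub_heegnerIndexLowerAtTwo` (crux `SplitBadTwoLowerHalfOfFacts`, route PrintCf2), node
R197a″ (i-a) of STUB-PLAN v7.1, remaining analytic lemma **R218 «PRIM₂»** (CRITIC-ROWS-g38: «p-adic `log` of a
principal-unit power series, de Shalit I.3.3 integrality with zero margin», S–M⁻, the largest open piece).

Contents (Mathlib only, 0 sorry, standard axioms): §1 margins `v_p(n)+1 ≤ n` (zero margin at `p = 2` iff `n ∈ {1,2}`;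
ramified margins `2v₂(n) ≤ n`, `4v₂(n) ≤ n+4`) · §2 `‖p^{d-1}/d‖ ≤ 1` in ANY ultrametric char-0 field with `‖p‖ < 1` ·
§3 integral series form a subring · §4 `scaledLog p y = Σ_{d≥1} (−1)^{d+1}(p^{d−1}/d) y^d` COEFFICIENTWISE FINITE and
integral (THE KERNEL) · §5 `C p · scaledLog p y = logOf (1 + C p·y)` (Mathlib's formal `PowerSeries.logOf`; no `p`-adic
convergence anywhere) · §6 formal-log calculus over any ℚ-algebra (`logOf (ab) = logOf a + logOf b`, powers, `subst`,
`map`, derivative-injectivity) · §7 COMPOSITION `log g − p⁻¹(log g^φ)∘f = scaledLog p y` from `g^p = (g^φ∘f)(1 + p y)` ·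
§8 the unit-ratio step from the coefficient congruence `g^p ≡ g^φ∘f (mod p)` and the END-TO-END theorem
`isIntegralSeries_logTilde_of_congruence` · §9 transport `∘ϑ`, `·Ω⁻¹` keeps the bound · §10 the `D`-side of the
transport is FORMAL: `(1+X)·(Ω⁻¹·A∘ϑ)′ = (A′/λ′)∘ϑ` from the differentiated comparison identity `(1+X)·(λ∘ϑ)′ = Ω` ·
§11 the RELATIVE TILDE is formal: `D_F(log̃ g) = δg − (π′/p)·((δg)^φ)∘f` from the log functional equation `λ^φ∘f = π′λ`
(so `mahlerD A_b = H_b` for `A_b = Ω⁻¹Θ(log̃ g_b∘ϑ)`, `H_b = Θ((δ_E g_b)~∘ϑ)` is an identity of formal power series).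

Literature anchors (presearch, corpus + galaxy): Coates–Sujatha, *Cyclotomic Fields and Zeta Values*, Lemma 2.5.1
(`𝓛(f) = p⁻¹ log(f^p/φ(f)) ∈ R` for ALL `f ∈ R^×` — the `𝔾_m` prototype; proof expands `log(1+ph)` `p`-adically);
de Shalit, *Iwasawa Theory of Elliptic Curves with CM*, I.3.3 (7) (relative Lubin–Tate version); Lang, GTM 121, Ch. 14 §2,
Lemma (Dieudonné–Dwork) (converse direction). Delta here: after `g(0) = 1` every coefficient is a FINITE sum, so the
formal `PowerSeries.logOf` suffices and the statement holds over any ultrametric char-0 normed field with `‖p‖ < 1`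
(no completeness, no `ℚ_p`-algebra structure, `p = 2` included with zero margin).

BSD is NOT proved by any of this.
-/

set_option linter.dupNamespace false
set_option linter.style.longLine false
set_option linter.unusedSectionVars false

namespace Summit.BirchSwinnertonDyer.BirchSwinnertonDyer.Cruxes.SplitBadTwoLowerHalfOfFacts.PrimTwoK1G37

open PowerSeries Finset

/-! ### §1. Margins: `v_p(n) + 1 ≤ n` (all `p`), zero margin at `p = 2`, ramified margins -/

section Margins

theorem padicValNat_lt_self {p : ℕ} (hp : p.Prime) {n : ℕ} (hn : n ≠ 0) : padicValNat p n < n := by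
  have h1 : p ^ padicValNat p n ≤ n := Nat.le_of_dvd (Nat.pos_of_ne_zero hn) pow_padicValNat_dvd
  have h2 : padicValNat p n < p ^ padicValNat p n := Nat.lt_pow_self hp.one_lt
  omega

/-- The `p`-free inequality behind de Shalit I.3.3 («`np ∣ pⁿ` for `n ≥ 1»`, read `p`-adically):
`v_p(n) + 1 ≤ n`, i.e. `p^{n-1}/n` is `p`-integral. -/
theorem padicValNat_add_one_le {p : ℕ} (hp : p.Prime) {n : ℕ} (hn : n ≠ 0) : padicValNat p n + 1 ≤ n :=
  padicValNat_lt_self hp hn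

/-- ZERO MARGIN at `p = 2`: equality `v₂(n) + 1 = n` holds exactly at `n = 1` and `n = 2`. -/
theorem margin_two_eq_zero_iff {n : ℕ} (hn : n ≠ 0) : padicValNat 2 n + 1 = n ↔ n = 1 ∨ n = 2 := by
  constructor
  · intro h
    have h1 : 2 ^ padicValNat 2 n ≤ n := Nat.le_of_dvd (Nat.pos_of_ne_zero hn) pow_padicValNat_dvd
    -- `2^v ≤ v + 1` forces `v ≤ 1`
    have hv : padicValNat 2 n ≤ 1 := by
      by_contra hv
      push Not at hv
      have : padicValNat 2 n + 2 ≤ 2 ^ padicValNat 2 n := by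
        have key : ∀ v : ℕ, 2 ≤ v → v + 2 ≤ 2 ^ v := by
          intro v hv2
          induction v with
          | zero => omega
          | succ k ih =>
            rcases Nat.lt_or_ge k 2 with hk | hk
            · interval_cases k <;> simp_all
            · have := ih hk; rw [pow_succ]; omega
        exact key _ hv
      omega
    interval_cases h' : padicValNat 2 n <;> omega
  · rintro (rfl | rfl)
    · simp
    · simp

/-- At an odd prime the margin is never zero beyond `n = 1`: `v_p(n) + 2 ≤ n` for `n ≥ 2`. -/
theorem padicValNat_add_two_le_of_odd_prime {p : ℕ} (hp : p.Prime) (hp2 : p ≠ 2) {n : ℕ} (hn : 2 ≤ n) :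
    padicValNat p n + 2 ≤ n := by
  have h3 : 3 ≤ p := by
    rcases hp.eq_two_or_odd' with h | h
    · exact absurd h hp2
    · have := hp.two_le; omega
  have h1 : p ^ padicValNat p n ≤ n := Nat.le_of_dvd (by omega) pow_padicValNat_dvd
  have key : ∀ v : ℕ, 1 ≤ v → v + 2 ≤ 3 ^ v := by
    intro v hv
    induction v with
    | zero => omega
    | succ k ih =>
      rcases Nat.eq_zero_or_pos k with rfl | hk
      · norm_num
      · have := ih hk; rw [pow_succ]; omega
  rcases Nat.eq_zero_or_pos (padicValNat p n) with h0 | hpos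
  · omega
  · have : 3 ^ padicValNat p n ≤ p ^ padicValNat p n := Nat.pow_le_pow_left h3 _
    have := key _ hpos
    omega

/-- RAMIFIED MARGIN, index `e = 2` (coefficients in `ℤ₂[ζ₄]`-type rings): `2·v₂(n) ≤ n`, i.e. the loss of
`(1/2)·log(1 + ϖ y)` with `v(ϖ) = 1/2` is at most ONE bit uniformly in `n`. -/
theorem two_mul_padicValNat_le (n : ℕ) : 2 * padicValNat 2 n ≤ n := by
  rcases Nat.eq_zero_or_pos n with rfl | hn
  · simp
  have h1 : 2 ^ padicValNat 2 n ≤ n := Nat.le_of_dvd hn pow_padicValNat_dvd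
  have key : ∀ v : ℕ, 2 * v ≤ 2 ^ v := by
    intro v
    induction v with
    | zero => simp
    | succ k ih =>
      have hk : 1 ≤ 2 ^ k := Nat.one_le_two_pow
      rw [pow_succ]; omega
  exact (key _).trans h1

/-- RAMIFIED MARGIN, index `e = 4` (`ℤ₂[ζ₈]`-type rings): `4·v₂(n) ≤ n + 4` — loss at most TWO bits. -/
theorem four_mul_padicValNat_le (n : ℕ) : 4 * padicValNat 2 n ≤ n + 4 := by
  rcases Nat.eq_zero_or_pos n with rfl | hn
  · simp
  have h1 : 2 ^ padicValNat 2 n ≤ n := Nat.le_of_dvd hn pow_padicValNat_dvd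
  have key : ∀ v : ℕ, 4 * v ≤ 2 ^ v + 4 := by
    intro v
    induction v with
    | zero => simp
    | succ k ih =>
      rcases Nat.lt_or_ge k 3 with hk | hk
      · interval_cases k <;> norm_num
      · have : 4 ≤ 2 ^ k := by
          calc (4 : ℕ) = 2 ^ 2 := by norm_num
            _ ≤ 2 ^ k := Nat.pow_le_pow_right (by norm_num) (by omega)
        rw [pow_succ]; omega
  have := key (padicValNat 2 n)
  omega

end Margins

/-! ### §2. The scalar `p^{d-1}/d` is `p`-integral in ANY ultrametric field of characteristic `0` with `‖p‖ < 1`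
(no `ℚ_p`-algebra structure, no completeness: `{n : ‖n‖ < 1}` is a prime ideal of `ℤ` containing `p`) -/

section Scalar

variable {p : ℕ} [Fact p.Prime]
variable {E : Type*} [NormedField E] [IsUltrametricDist E] [CharZero E]

/-- In an ultrametric field with `‖p‖ < 1`, every integer prime to `p` has norm `1` (Bezout). -/
theorem norm_natCast_eq_one_of_not_dvd (hp : ‖(p : E)‖ < 1) {m : ℕ} (hm : ¬ p ∣ m) : ‖(m : E)‖ = 1 := by
  have hP : p.Prime := Fact.out
  have hcop : IsCoprime (p : ℤ) (m : ℤ) :=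
    Nat.isCoprime_iff_coprime.mpr ((Nat.Prime.coprime_iff_not_dvd hP).mpr hm)
  obtain ⟨a, b, hab⟩ := hcop
  refine le_antisymm (IsUltrametricDist.norm_natCast_le_one E m) ?_
  by_contra hlt
  rw [not_le] at hlt
  have h1 : (a : E) * (p : E) + (b : E) * (m : E) = 1 := by exact_mod_cast congrArg (fun z : ℤ => (z : E)) hab
  have key : ‖(a : E) * (p : E) + (b : E) * (m : E)‖ < 1 := by
    refine lt_of_le_of_lt (IsUltrametricDist.norm_add_le_max _ _) (max_lt ?_ ?_)
    · rw [norm_mul]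
      calc ‖(a : E)‖ * ‖(p : E)‖ ≤ 1 * ‖(p : E)‖ := by
            gcongr; exact IsUltrametricDist.norm_intCast_le_one E a
        _ < 1 := by rw [one_mul]; exact hp
    · rw [norm_mul]
      calc ‖(b : E)‖ * ‖(m : E)‖ ≤ 1 * ‖(m : E)‖ := by
            gcongr; exact IsUltrametricDist.norm_intCast_le_one E b
        _ < 1 := by rw [one_mul]; exact hlt
  rw [h1, norm_one] at key
  exact lt_irrefl _ key

/-- ★ `‖p^{d-1} / d‖ ≤ 1` for `d ≥ 1`: the scalar of the `d`-th term of `p⁻¹·log(1 + p y)` is `p`-integral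
(`d = p^v·m`, `p ∤ m`, `v ≤ d − 1`). -/
theorem norm_pow_div_natCast_le_one (hp : ‖(p : E)‖ < 1) {d : ℕ} (hd : d ≠ 0) :
    ‖(p : E) ^ (d - 1) / (d : E)‖ ≤ 1 := by
  have hP : p.Prime := Fact.out
  obtain ⟨v, m, hm, hdvm⟩ := Nat.exists_eq_pow_mul_and_not_dvd hd p hP.ne_one
  have hvd : v < d := by
    have hm0 : 0 < m := Nat.pos_of_ne_zero (by rintro rfl; simp at hm)
    have h1 : v < p ^ v := Nat.lt_pow_self hP.one_lt
    have h2 : p ^ v ≤ p ^ v * m := Nat.le_mul_of_pos_right _ hm0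
    omega
  have hpE : (p : E) ≠ 0 := Nat.cast_ne_zero.mpr hP.ne_zero
  have hsplit : (p : E) ^ (d - 1) / (d : E) = (p : E) ^ (d - 1 - v) * (m : E)⁻¹ := by
    have hden : (d : E) = (p : E) ^ v * (m : E) := by rw [hdvm]; push_cast; ring
    have hnum : (p : E) ^ (d - 1) = (p : E) ^ (d - 1 - v) * (p : E) ^ v := by
      rw [← pow_add]; congr 1; omega
    have hpv : (p : E) ^ v ≠ 0 := pow_ne_zero _ hpE
    rw [hden, hnum, mul_div_assoc, ← div_div, div_self hpv, one_div]
  rw [hsplit, norm_mul, norm_inv, norm_natCast_eq_one_of_not_dvd hp hm, inv_one, mul_one, norm_pow]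
  exact pow_le_one₀ (norm_nonneg _) hp.le

end Scalar

/-! ### §3. Integral power series (all coefficients of norm ≤ 1) are closed under `*`, `^` -/

section Integral

variable {E : Type*} [NormedField E] [IsUltrametricDist E]

/-- «integral coefficients» in a normed field. -/
def IsIntegralSeries (f : E⟦X⟧) : Prop := ∀ k, ‖coeff k f‖ ≤ 1

theorem IsIntegralSeries.mul {f g : E⟦X⟧} (hf : IsIntegralSeries f) (hg : IsIntegralSeries g) :
    IsIntegralSeries (f * g) := by
  intro k
  rw [coeff_mul]
  refine IsUltrametricDist.norm_sum_le_of_forall_le_of_nonneg zero_le_one ?_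
  intro ij _
  rw [norm_mul]
  calc ‖coeff ij.1 f‖ * ‖coeff ij.2 g‖ ≤ 1 * 1 :=
        mul_le_mul (hf _) (hg _) (norm_nonneg _) zero_le_one
    _ = 1 := one_mul 1

theorem IsIntegralSeries.one : IsIntegralSeries (1 : E⟦X⟧) := by
  intro k
  rw [coeff_one]
  split_ifs <;> simp

theorem IsIntegralSeries.pow {f : E⟦X⟧} (hf : IsIntegralSeries f) (n : ℕ) : IsIntegralSeries (f ^ n) := by
  induction n with
  | zero => simpa using IsIntegralSeries.one
  | succ k ih => rw [pow_succ]; exact ih.mul hf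

theorem IsIntegralSeries.add {f g : E⟦X⟧} (hf : IsIntegralSeries f) (hg : IsIntegralSeries g) :
    IsIntegralSeries (f + g) := by
  intro k
  rw [map_add]
  exact (IsUltrametricDist.norm_add_le_max _ _).trans (max_le (hf k) (hg k))

theorem IsIntegralSeries.neg {f : E⟦X⟧} (hf : IsIntegralSeries f) : IsIntegralSeries (-f) := by
  intro k; rw [map_neg, norm_neg]; exact hf k

theorem IsIntegralSeries.sub {f g : E⟦X⟧} (hf : IsIntegralSeries f) (hg : IsIntegralSeries g) :
    IsIntegralSeries (f - g) := by
  rw [sub_eq_add_neg]; exact hf.add hg.neg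

theorem IsIntegralSeries.C_mul {f : E⟦X⟧} (hf : IsIntegralSeries f) {c : E} (hc : ‖c‖ ≤ 1) :
    IsIntegralSeries (C c * f) := by
  intro k
  rw [coeff_C_mul, norm_mul]
  calc ‖c‖ * ‖coeff k f‖ ≤ 1 * 1 := mul_le_mul hc (hf k) (norm_nonneg _) zero_le_one
    _ = 1 := one_mul 1

end Integral

/-! ### §4. THE KERNEL: `scaledLog p y = Σ_{d=1}^{k} (−1)^{d+1} p^{d−1}/d · coeff_k(y^d)` is integral -/

section Kernel

variable {p : ℕ} [Fact p.Prime]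
variable {E : Type*} [NormedField E] [IsUltrametricDist E] [CharZero E]

/-- The term scalar `(−1)^{d+1} p^{d-1} / d`. -/
def logScalar (p : ℕ) (E : Type*) [NormedField E] (d : ℕ) : E := (-1) ^ (d + 1) * (p : E) ^ (d - 1) / (d : E)

theorem norm_logScalar_le_one (hp : ‖(p : E)‖ < 1) {d : ℕ} (hd : d ≠ 0) : ‖logScalar p E d‖ ≤ 1 := by
  unfold logScalar
  rw [mul_div_assoc, norm_mul, norm_pow, norm_neg, norm_one, one_pow, one_mul]
  exact norm_pow_div_natCast_le_one hp hd

/-- `p⁻¹ · log(1 + p·y)` written COEFFICIENTWISE as finite sums (for `y(0) = 0` the `d`-th power `y^d` has no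
coefficient below degree `d`, so degree `k` only sees `d ≤ k`). -/
noncomputable def scaledLog (p : ℕ) (y : E⟦X⟧) : E⟦X⟧ :=
  PowerSeries.mk fun k => ∑ d ∈ Finset.Icc 1 k, logScalar p E d * coeff k (y ^ d)

theorem coeff_scaledLog (y : E⟦X⟧) (k : ℕ) :
    coeff k (scaledLog p y) = ∑ d ∈ Finset.Icc 1 k, logScalar p E d * coeff k (y ^ d) := by
  simp [scaledLog]

/-- ★★ THE INTEGRALITY KERNEL (de Shalit I.3.3 (7), the analytic content of R218 «PRIM₂»): for an integral `y`,
every coefficient of `p⁻¹·log(1 + p y)` has norm `≤ 1` — for EVERY prime `p` and every ultrametric field of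
characteristic `0` with `‖p‖ < 1` (no completeness, no `ℚ_p`-structure), by `v_p(d) + 1 ≤ d` alone. -/
theorem isIntegralSeries_scaledLog (hp : ‖(p : E)‖ < 1) {y : E⟦X⟧} (hy : IsIntegralSeries y) :
    IsIntegralSeries (scaledLog p y) := by
  intro k
  rw [coeff_scaledLog]
  refine IsUltrametricDist.norm_sum_le_of_forall_le_of_nonneg zero_le_one ?_
  intro d hd
  rw [Finset.mem_Icc] at hd
  rw [norm_mul]
  calc ‖logScalar p E d‖ * ‖coeff k (y ^ d)‖ ≤ 1 * 1 :=
        mul_le_mul (norm_logScalar_le_one hp (by omega)) (hy.pow d k) (norm_nonneg _) zero_le_one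
    _ = 1 := one_mul 1

end Kernel

/-! ### §5. Identification with Mathlib's formal logarithm: `C p · scaledLog p y = logOf (1 + C p · y)` -/

section Identification

variable {p : ℕ} [Fact p.Prime]
variable {E : Type*} [NormedField E] [IsUltrametricDist E] [CharZero E]

/-- Powers of a series without constant term have no low coefficients. -/
theorem coeff_pow_eq_zero_of_lt {y : E⟦X⟧} (hy0 : constantCoeff y = 0) {d k : ℕ} (hkd : k < d) :
    coeff k (y ^ d) = 0 := by
  obtain ⟨y', hy'⟩ := X_dvd_iff.mpr hy0
  rw [hy', mul_pow, coeff_X_pow_mul']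
  simp [Nat.not_le.mpr hkd]

/-- ★ For `y(0) = 0`: `C p · scaledLog p y = logOf (1 + C p · y)` — so `scaledLog` IS `p⁻¹·log(1 + p y)` and all its
coefficients are FINITE sums (no `p`-adic convergence anywhere). -/
theorem C_mul_scaledLog_eq_logOf {y : E⟦X⟧} (hy0 : constantCoeff y = 0) :
    C (p : E) * scaledLog p y = logOf (1 + C (p : E) * y) := by
  have hb0 : constantCoeff (C (p : E) * y) = 0 := by rw [map_mul, hy0, mul_zero]
  have hb : HasSubst (C (p : E) * y) := HasSubst.of_constantCoeff_zero' hb0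
  ext k
  rw [coeff_C_mul, coeff_scaledLog, logOf_eq, add_sub_cancel_left, coeff_subst' hb,
    finsum_eq_sum_of_support_subset _ (s := Finset.Icc 1 k)]
  · rw [Finset.mul_sum]
    refine Finset.sum_congr rfl fun d hd => ?_
    rw [Finset.mem_Icc] at hd
    have hd0 : d ≠ 0 := by omega
    have hscal : algebraMap ℚ E ((-1 : ℚ) ^ (d + 1) / d) = (-1 : E) ^ (d + 1) / (d : E) := by
      rw [map_div₀, map_pow (algebraMap ℚ E), map_neg (algebraMap ℚ E), map_one, map_natCast]
    rw [coeff_log, if_neg hd0, mul_pow, ← map_pow C, coeff_C_mul, smul_eq_mul, hscal]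
    unfold logScalar
    obtain ⟨e, rfl⟩ : ∃ e, d = e + 1 := ⟨d - 1, by omega⟩
    rw [Nat.add_sub_cancel, pow_succ (p : E) e]
    ring
  · intro d hd
    rw [Function.mem_support] at hd
    rw [Finset.coe_Icc, Set.mem_Icc]
    refine ⟨?_, ?_⟩
    · rcases Nat.eq_zero_or_pos d with rfl | h
      · simp at hd
      · exact h
    · by_contra h
      rw [Nat.not_le] at h
      exact hd (by rw [coeff_pow_eq_zero_of_lt hb0 h, smul_zero])

end Identification

/-! ### §6. Formal-log calculus over any ℚ-algebra: `logOf (a·b) = logOf a + logOf b`, powers, `subst`, `map` -/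

section LogCalculus

variable {A : Type*} [CommRing A] [Algebra ℚ A]

/-- Over a ℚ-algebra a power series is determined by its derivative and its constant term. -/
theorem eq_of_derivative_eq {f g : A⟦X⟧} (hD : d⁄dX A f = d⁄dX A g)
    (hc : constantCoeff f = constantCoeff g) : f = g := by
  ext n
  cases n with
  | zero => simpa [coeff_zero_eq_constantCoeff] using hc
  | succ n =>
    have equ : coeff n (d⁄dX A f) = coeff n (d⁄dX A g) := by rw [hD]
    rw [coeff_derivative, coeff_derivative] at equ
    have hn : ((n : A) + 1) * algebraMap ℚ A ((n + 1 : ℚ)⁻¹) = 1 := by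
      rw [show ((n : A) + 1) = algebraMap ℚ A (n + 1) by simp, ← map_mul,
        mul_inv_cancel₀ (by positivity), map_one]
    calc coeff (n + 1) f = coeff (n + 1) f * (((n : A) + 1) * algebraMap ℚ A ((n + 1 : ℚ)⁻¹)) := by
          rw [hn, mul_one]
      _ = coeff (n + 1) g * (((n : A) + 1) * algebraMap ℚ A ((n + 1 : ℚ)⁻¹)) := by
          rw [← mul_assoc, ← mul_assoc, equ]
      _ = coeff (n + 1) g := by rw [hn, mul_one]

/-- The geometric series `Σ (-1)^n X^n` is the inverse of `1 + X`. -/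
theorem one_add_X_mul_geom : (1 + X : A⟦X⟧) * (PowerSeries.mk fun n => algebraMap ℚ A ((-1 : ℚ) ^ n)) = 1 := by
  ext n
  rw [add_mul, one_mul, map_add, coeff_one]
  cases n with
  | zero => simp
  | succ n =>
    rw [coeff_succ_X_mul, coeff_mk, coeff_mk, if_neg (Nat.succ_ne_zero n), pow_succ]
    simp

theorem hasSubst_sub_one {a : A⟦X⟧} (ha : constantCoeff a = 1) : HasSubst (a - 1) :=
  HasSubst.of_constantCoeff_zero' (by rw [map_sub, map_one, ha, sub_self])

/-- ★ `logOf a` has logarithmic derivative `a′/a`: `(d/dX logOf a) · a = d/dX a` for `a(0) = 1`. -/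
theorem derivative_logOf_mul_self {a : A⟦X⟧} (ha : constantCoeff a = 1) :
    d⁄dX A (logOf a) * a = d⁄dX A a := by
  have hs := hasSubst_sub_one ha
  have hgeom : (PowerSeries.mk fun n => algebraMap ℚ A ((-1 : ℚ) ^ n)).subst (a - 1) * a = 1 := by
    have := congrArg (PowerSeries.subst (a - 1)) (one_add_X_mul_geom (A := A))
    rw [subst_mul hs, subst_add hs, subst_X hs, ← coe_substAlgHom hs, map_one, add_sub_cancel] at this
    rw [mul_comm] at this
    rw [mul_comm, coe_substAlgHom hs] at this
    -- `this : a * subst (a-1) geom = 1` up to commutation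
    simpa [mul_comm] using this
  rw [logOf_eq, derivative_subst A hs, deriv_log, map_sub, Derivation.map_one_eq_zero, sub_zero,
    mul_right_comm, hgeom, one_mul]

/-- ★★ `logOf (a · b) = logOf a + logOf b` for `a(0) = b(0) = 1` (formal, any ℚ-algebra). -/
theorem logOf_mul {a b : A⟦X⟧} (ha : constantCoeff a = 1) (hb : constantCoeff b = 1) :
    logOf (a * b) = logOf a + logOf b := by
  have hab : constantCoeff (a * b) = 1 := by rw [map_mul, ha, hb, mul_one]
  have hu : IsUnit (a * b) := isUnit_iff_constantCoeff.mpr (by rw [hab]; exact isUnit_one)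
  apply eq_of_derivative_eq
  · apply (IsUnit.mul_left_inj hu).mp
    have e1 := derivative_logOf_mul_self ha
    have e2 := derivative_logOf_mul_self hb
    rw [derivative_logOf_mul_self hab, map_add, Derivation.leibniz, smul_eq_mul, smul_eq_mul]
    linear_combination (-b) * e1 + (-a) * e2
  · rw [constantCoeff_logOf hab, map_add, constantCoeff_logOf ha, constantCoeff_logOf hb, add_zero]

theorem logOf_one : logOf (1 : A⟦X⟧) = 0 := by
  apply eq_of_derivative_eq
  · have := derivative_logOf_mul_self (A := A) (a := 1) (map_one _)
    rw [mul_one, Derivation.map_one_eq_zero] at this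
    rw [this, map_zero]
  · rw [constantCoeff_logOf (map_one _), map_zero]

/-- `logOf (a^n) = n · logOf a`. -/
theorem logOf_pow {a : A⟦X⟧} (ha : constantCoeff a = 1) (n : ℕ) : logOf (a ^ n) = (n : A⟦X⟧) * logOf a := by
  induction n with
  | zero => simp [logOf_one]
  | succ k ih =>
    have hak : constantCoeff (a ^ k) = 1 := by rw [map_pow, ha, one_pow]
    rw [pow_succ, logOf_mul hak ha, ih, Nat.cast_succ]
    ring

/-- `logOf` commutes with substitution of a series without constant term. -/
theorem logOf_subst {a f : A⟦X⟧} (ha : constantCoeff a = 1) (hf : constantCoeff f = 0) :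
    (logOf a).subst f = logOf (a.subst f) := by
  have hs := hasSubst_sub_one ha
  have hf' : HasSubst f := HasSubst.of_constantCoeff_zero' hf
  rw [logOf_eq, logOf_eq, subst_comp_subst_apply hs hf', subst_sub hf', ← coe_substAlgHom hf', map_one]

/-- Substituting a series without constant term does not change the constant term. -/
theorem constantCoeff_subst_of_constantCoeff_eq_zero {f : A⟦X⟧} (hf : constantCoeff f = 0) (a : A⟦X⟧) :
    constantCoeff (a.subst f) = constantCoeff a := by
  have hf' : HasSubst f := HasSubst.of_constantCoeff_zero' hf
  rw [constantCoeff_eq, constantCoeff_subst hf' a, finsum_eq_single _ 0]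
  · simp
  · intro d hd
    rw [← constantCoeff_eq, map_pow, hf, zero_pow hd, smul_zero]

/-- `logOf` commutes with coefficientwise ring maps (e.g. a Frobenius lift `φ`). -/
theorem map_logOf {A' : Type*} [CommRing A'] [Algebra ℚ A'] (φ : A →+* A') {a : A⟦X⟧}
    (ha : constantCoeff a = 1) : (logOf a).map φ = logOf (a.map φ) := by
  have hs := hasSubst_sub_one ha
  rw [logOf_eq, logOf_eq]
  have h1 : (PowerSeries.map φ) ((log A).subst (a - 1)) = ((log A).map φ).subst ((a - 1).map φ) :=
    map_subst hs (log A)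
  rw [h1, map_log, map_sub, map_one]

end LogCalculus

/-! ### §7. COMPOSITION = de Shalit I.3.3 (7) at every prime, in the form R218 «PRIM₂» needs:
`log g − p⁻¹ · log(g^φ ∘ f)` is an INTEGRAL series — from the congruence datum `g^p = (g^φ∘f)(1 + p y)` alone. -/

section Composition

variable {p : ℕ} [Fact p.Prime]
variable {E : Type*} [NormedField E] [IsUltrametricDist E] [CharZero E]

/-- ★★★ STRONGEST PROVABLE FORM of the analytic kernel of R218 «PRIM₂» (de Shalit I.3.3 (7)): for ANY unit
series `g` with `g(0) = 1` (no norm-coherence), any coefficient endomorphism `φ` (Frobenius lift) and any `f` with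
`f(0) = 0` (Lubin–Tate endomorphism `[π]`), the Frobenius congruence datum
`g^p = (g^φ ∘ f) · (1 + p·y)` with `y ∈ X·𝒪⟦X⟧` forces
`log g − p⁻¹·(log g^φ) ∘ f = p⁻¹·log(1 + p y) = scaledLog p y`, an INTEGRAL series (`C = 1`). -/
theorem logTilde_eq_scaledLog (φ : E →+* E) {f g y : E⟦X⟧}
    (hf0 : constantCoeff f = 0) (hg0 : constantCoeff g = 1) (hy0 : constantCoeff y = 0)
    (hcong : g ^ p = (g.map φ).subst f * (1 + C (p : E) * y)) :
    logOf g - C ((p : E)⁻¹) * (logOf (g.map φ)).subst f = scaledLog p y := by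
  have hp : p.Prime := Fact.out
  have hpE : (p : E) ≠ 0 := Nat.cast_ne_zero.mpr hp.ne_zero
  have hgφ : constantCoeff (g.map φ) = 1 := by
    rw [← coeff_zero_eq_constantCoeff_apply, coeff_map, coeff_zero_eq_constantCoeff_apply, hg0, map_one]
  have h1 : constantCoeff ((g.map φ).subst f) = 1 := by
    rw [constantCoeff_subst_of_constantCoeff_eq_zero hf0, hgφ]
  have h2 : constantCoeff (1 + C (p : E) * y) = 1 := by
    rw [map_add, map_one, map_mul, hy0, mul_zero, add_zero]
  have key := congrArg logOf hcong
  rw [logOf_pow hg0, logOf_mul h1 h2, ← C_mul_scaledLog_eq_logOf hy0, ← logOf_subst hgφ hf0,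
    show ((p : ℕ) : E⟦X⟧) = C (p : E) from (map_natCast C p).symm] at key
  have hunit : C ((p : E)⁻¹) * C (p : E) = 1 := by rw [← map_mul, inv_mul_cancel₀ hpE, map_one]
  linear_combination (C ((p : E)⁻¹)) * key - (logOf g - scaledLog p y) * hunit

/-- ★★★ … hence INTEGRAL (the `BoundedPrimitive`-type bound with `C = 1`), for every prime `p`. -/
theorem isIntegralSeries_logTilde (hp : ‖(p : E)‖ < 1) (φ : E →+* E) {f g y : E⟦X⟧}
    (hf0 : constantCoeff f = 0) (hg0 : constantCoeff g = 1) (hy0 : constantCoeff y = 0) (hy : IsIntegralSeries y)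
    (hcong : g ^ p = (g.map φ).subst f * (1 + C (p : E) * y)) :
    IsIntegralSeries (logOf g - C ((p : E)⁻¹) * (logOf (g.map φ)).subst f) := by
  rw [logTilde_eq_scaledLog φ hf0 hg0 hy0 hcong]
  exact isIntegralSeries_scaledLog hp hy

end Composition

/-! ### §8. From the tree's congruence currency to the datum of §7: `G ≡ H (mod p)` coefficientwise, `G(0) = H(0) = 1`
⟹ `G = H·(1 + p·y)` with `y ∈ X·𝒪⟦X⟧` (inverse of an integral principal series is integral) -/

section UnitRatio

variable {p : ℕ} [Fact p.Prime]
variable {E : Type*} [NormedField E] [IsUltrametricDist E] [CharZero E]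

/-- The inverse of an integral series with constant term `1` is integral. -/
theorem IsIntegralSeries.inv_of_constantCoeff_eq_one {h : E⟦X⟧} (hh : IsIntegralSeries h)
    (h0 : constantCoeff h = 1) : IsIntegralSeries h⁻¹ := by
  intro k
  induction k using Nat.strong_induction_on with
  | _ k ih =>
    rw [coeff_inv, h0, inv_one]
    split_ifs with hk
    · simp
    · rw [neg_one_mul, norm_neg]
      refine IsUltrametricDist.norm_sum_le_of_forall_le_of_nonneg zero_le_one fun x _ => ?_
      split_ifs with hx2
      · rw [norm_mul]
        calc ‖coeff x.1 h‖ * ‖coeff x.2 h⁻¹‖ ≤ 1 * 1 :=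
              mul_le_mul (hh _) (ih _ hx2) (norm_nonneg _) zero_le_one
          _ = 1 := one_mul 1
      · simp

/-- ★★ UNIT-RATIO STEP (de Shalit I.3.3, «`g^p ≡ g^φ∘f mod ℘′` ⟹ the ratio is a principal unit `1 + p y`»): if
`p⁻¹·(G − H)` is integral (`G ≡ H mod p` coefficientwise), `H` is integral and `G(0) = H(0) = 1`, then
`G = H·(1 + p·y)` with `y = p⁻¹(G − H)·H⁻¹` integral and `y(0) = 0` — exactly the hypothesis `hcong` of §7 with
`G = g^p`, `H = g^φ ∘ f`. -/
theorem exists_unitRatio {G H : E⟦X⟧} (hG0 : constantCoeff G = 1) (hH0 : constantCoeff H = 1)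
    (hH : IsIntegralSeries H) (hcong : IsIntegralSeries (C ((p : E)⁻¹) * (G - H))) :
    ∃ y : E⟦X⟧, constantCoeff y = 0 ∧ IsIntegralSeries y ∧ G = H * (1 + C (p : E) * y) := by
  have hP : p.Prime := Fact.out
  have hpE : (p : E) ≠ 0 := Nat.cast_ne_zero.mpr hP.ne_zero
  have hHu : constantCoeff H ≠ 0 := by rw [hH0]; exact one_ne_zero
  refine ⟨C ((p : E)⁻¹) * (G - H) * H⁻¹, ?_, hcong.mul (hH.inv_of_constantCoeff_eq_one hH0), ?_⟩
  · rw [map_mul, map_mul, map_sub, hG0, hH0, sub_self, mul_zero, zero_mul]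
  · have hunit : C (p : E) * C ((p : E)⁻¹) = 1 := by rw [← map_mul, mul_inv_cancel₀ hpE, map_one]
    have hHinv : H * H⁻¹ = 1 := PowerSeries.mul_inv_cancel H hHu
    linear_combination (-(G - H)) * hHinv + (-(G - H) * H * H⁻¹) * hunit

/-- ★★★ END-TO-END (strongest provable form, all primes, any ultrametric char-0 field with `‖p‖ < 1`): an INTEGRAL
principal series `g` (`g(0) = 1`), a coefficient endomorphism `φ` preserving integrality of `g`, an integral `f` with
`f(0) = 0`, and the coefficientwise Frobenius congruence `g^p ≡ g^φ ∘ f (mod p)` give an INTEGRAL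
`log g − p⁻¹·(log g^φ)∘f` — de Shalit I.3.3 (7) with constant `C = 1` and no norm-coherence hypothesis. -/
theorem isIntegralSeries_logTilde_of_congruence (hp : ‖(p : E)‖ < 1) (φ : E →+* E) {f g : E⟦X⟧}
    (hf0 : constantCoeff f = 0) (hg0 : constantCoeff g = 1)
    (hgφf : IsIntegralSeries ((g.map φ).subst f))
    (hcong : IsIntegralSeries (C ((p : E)⁻¹) * (g ^ p - (g.map φ).subst f))) :
    IsIntegralSeries (logOf g - C ((p : E)⁻¹) * (logOf (g.map φ)).subst f) := by
  have hgp0 : constantCoeff (g ^ p) = 1 := by rw [map_pow, hg0, one_pow]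
  have hgφ : constantCoeff (g.map φ) = 1 := by
    rw [← coeff_zero_eq_constantCoeff_apply, coeff_map, coeff_zero_eq_constantCoeff_apply, hg0, map_one]
  have h1 : constantCoeff ((g.map φ).subst f) = 1 := by
    rw [constantCoeff_subst_of_constantCoeff_eq_zero hf0, hgφ]
  obtain ⟨y, hy0, hy, hprod⟩ := exists_unitRatio hgp0 h1 hgφf hcong
  exact isIntegralSeries_logTilde hp φ hf0 hg0 hy0 hy hprod

end UnitRatio

/-! ### §9. Transport keeps the bound: substituting an integral series without constant term (the comparison
isomorphism `ϑ`, `ϑ(0) = 0`) into an integral series gives an integral series — so `A_b = Ω⁻¹·Θ(log̃ g_b ∘ ϑ)` has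
`‖coeff‖ ≤ ‖Ω⁻¹‖` (`= 1` for a unit period), i.e. the constant `C` of `BoundedPrimitive` is consumption-irrelevant. -/

section Transport

variable {E : Type*} [NormedField E] [IsUltrametricDist E] [CharZero E]

theorem IsIntegralSeries.subst {A ϑ : E⟦X⟧} (hA : IsIntegralSeries A) (hϑ : IsIntegralSeries ϑ)
    (hϑ0 : constantCoeff ϑ = 0) : IsIntegralSeries (A.subst ϑ) := by
  intro k
  have hs : HasSubst ϑ := HasSubst.of_constantCoeff_zero' hϑ0
  rw [coeff_subst' hs, finsum_eq_sum_of_support_subset _ (s := Finset.range (k + 1))]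
  · refine IsUltrametricDist.norm_sum_le_of_forall_le_of_nonneg zero_le_one fun d _ => ?_
    rw [smul_eq_mul, norm_mul]
    calc ‖coeff d A‖ * ‖coeff k (ϑ ^ d)‖ ≤ 1 * 1 :=
          mul_le_mul (hA d) (hϑ.pow d k) (norm_nonneg _) zero_le_one
      _ = 1 := one_mul 1
  · intro d hd
    rw [Function.mem_support] at hd
    rw [Finset.coe_range, Set.mem_Iio]
    by_contra h
    rw [Nat.not_lt] at h
    exact hd (by rw [coeff_pow_eq_zero_of_lt hϑ0 (by omega), smul_zero])

/-- The transported primitive `C Ω⁻¹ · (A ∘ ϑ)` is bounded by `‖Ω⁻¹‖` (any scalar; `= 1` for a unit). -/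
theorem norm_coeff_transport_le {A ϑ : E⟦X⟧} (hA : IsIntegralSeries A) (hϑ : IsIntegralSeries ϑ)
    (hϑ0 : constantCoeff ϑ = 0) (Ωinv : E) (k : ℕ) : ‖coeff k (C Ωinv * A.subst ϑ)‖ ≤ ‖Ωinv‖ := by
  rw [coeff_C_mul, norm_mul]
  calc ‖Ωinv‖ * ‖coeff k (A.subst ϑ)‖ ≤ ‖Ωinv‖ * 1 :=
        mul_le_mul_of_nonneg_left (hA.subst hϑ hϑ0 k) (norm_nonneg _)
    _ = ‖Ωinv‖ := mul_one _

end Transport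

/-! ### §10. The `D`-side of the transport is FORMAL: `(1+X)·d/dX (Ω⁻¹·A∘ϑ) = (A′/λ′)∘ϑ` from the differentiated
comparison identity `(1+X)·(λ∘ϑ)′ = Ω` (tree: `λ_F∘ϑ = Ω·log(1+S)`, `LubinTateComparison*`). With `A = log̃ g` this makes
`mahlerD A_b` the transport of the `F`-invariant derivative `D_F log̃ g`; that `D_F log̃ g = (δ_E g)~` (relative tilde, dilation
unit `u_L = π/2`) is the SEAM of k3-g38 (row 111, landed) + the tree's `λ^φ∘f = π·λ` — NOT re-derived here (K52). -/

section MahlerTransport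

variable {E : Type*} [Field E]

theorem subst_inv_of_constantCoeff_ne_zero {L ϑ : E⟦X⟧} (hϑ0 : constantCoeff ϑ = 0) (hL : constantCoeff L ≠ 0) :
    (L⁻¹).subst ϑ = (L.subst ϑ)⁻¹ := by
  have hs : HasSubst ϑ := HasSubst.of_constantCoeff_zero' hϑ0
  have hL' : constantCoeff (L.subst ϑ) ≠ 0 := by
    rw [constantCoeff_eq, constantCoeff_subst hs L, finsum_eq_single _ 0]
    · simpa using hL
    · intro d hd
      rw [← constantCoeff_eq, map_pow, hϑ0, zero_pow hd, smul_zero]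
  have hmul : (L⁻¹).subst ϑ * L.subst ϑ = 1 := by
    rw [← subst_mul hs, PowerSeries.inv_mul_cancel _ hL, ← coe_substAlgHom hs, map_one]
  have := (eq_mul_inv_iff_mul_eq hL').mpr hmul
  rwa [one_mul] at this

/-- ★ `D`-TRANSPORT: `(1 + X)·d/dX (C Ω⁻¹ · A∘ϑ) = (A′·(λ′)⁻¹)∘ϑ` whenever `(1+X)·(λ∘ϑ)′ = Ω`, `λ′(0) ≠ 0`, `ϑ(0) = 0`. -/
theorem mahler_transport {lam ϑ A : E⟦X⟧} (hϑ0 : constantCoeff ϑ = 0) (hlam : constantCoeff (d⁄dX E lam) ≠ 0)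
    {Ω : E} (hΩ : Ω ≠ 0) (hcomp : (1 + X : E⟦X⟧) * d⁄dX E (lam.subst ϑ) = C Ω) :
    (1 + X : E⟦X⟧) * d⁄dX E (C Ω⁻¹ * A.subst ϑ) = (d⁄dX E A * (d⁄dX E lam)⁻¹).subst ϑ := by
  have hs : HasSubst ϑ := HasSubst.of_constantCoeff_zero' hϑ0
  have hl0 : constantCoeff ((d⁄dX E lam).subst ϑ) ≠ 0 := by
    rw [constantCoeff_eq, constantCoeff_subst hs, finsum_eq_single _ 0]
    · simpa using hlam
    · intro d hd
      rw [← constantCoeff_eq, map_pow, hϑ0, zero_pow hd, smul_zero]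
  have hD : d⁄dX E (C Ω⁻¹ * A.subst ϑ) = C Ω⁻¹ * ((d⁄dX E A).subst ϑ * d⁄dX E ϑ) := by
    rw [← smul_eq_C_mul, Derivation.map_smul, derivative_subst E hs, smul_eq_C_mul]
  rw [derivative_subst E hs] at hcomp
  have hmi : (d⁄dX E lam).subst ϑ * ((d⁄dX E lam).subst ϑ)⁻¹ = 1 := PowerSeries.mul_inv_cancel _ hl0
  have hΩ1 : C Ω⁻¹ * C Ω = (1 : E⟦X⟧) := by rw [← map_mul, inv_mul_cancel₀ hΩ, map_one]
  rw [hD, subst_mul hs, subst_inv_of_constantCoeff_ne_zero hϑ0 hlam]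
  linear_combination (C Ω⁻¹ * (d⁄dX E A).subst ϑ * ((d⁄dX E lam).subst ϑ)⁻¹) * hcomp
    - ((1 + X : E⟦X⟧) * C Ω⁻¹ * (d⁄dX E A).subst ϑ * d⁄dX E ϑ) * hmi
    + ((d⁄dX E A).subst ϑ * ((d⁄dX E lam).subst ϑ)⁻¹) * hΩ1

/-- The `F`-invariant derivative of `logOf g` is the LOGARITHMIC derivative `δ g = g′/(λ′·g)` (for `g(0) = 1`):
`(logOf g)′·(λ′)⁻¹ = g′·g⁻¹·(λ′)⁻¹` — so `A = log̃ g` feeds `mahler_transport` with `A′/λ′ = δg − p⁻¹·((log g^φ)′∘f·f′)/λ′`. -/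
theorem derivative_logOf_eq {g : E⟦X⟧} [Algebra ℚ E] (hg0 : constantCoeff g = 1) :
    d⁄dX E (logOf g) = d⁄dX E g * g⁻¹ := by
  have hg : constantCoeff g ≠ 0 := by rw [hg0]; exact one_ne_zero
  exact (eq_mul_inv_iff_mul_eq hg).mpr (derivative_logOf_mul_self hg0)

end MahlerTransport

/-! ### §11. The RELATIVE TILDE from the log-tilde is FORMAL too: with the logarithm functional equation
`λ^φ∘f = π′·λ` of the relative Lubin–Tate group (differentiated: `(λ^φ)′∘f · f′ = π′·λ′`), the `F`-invariant derivative
`D_F := (λ′)⁻¹·d/dX` of `log̃ g = logOf g − p⁻¹·(logOf g^φ)∘f` is `δ g − (π′/p)·(δ^φ g^φ)∘f` with `δ h := h′·h⁻¹·(λ′)⁻¹`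
(de Shalit's `δ_E`), i.e. the tree's `relTildeSeries (δ_E g)` with dilation unit `u_L = π′/p` (`hu : π = q·u`; at
`F = ℚ₂`: `q = p = 2`). Together with §10: `mahlerD (Ω⁻¹·(log̃ g)∘ϑ) = ((δ_E g)~)∘ϑ` — BOTH clauses of
`BoundedPrimitive` are now formal identities + the §8 bound; what remains is instantiation on the tree's carriers. -/

section RelativeTilde

variable {E : Type*} [Field E] [CharZero E]

theorem constantCoeff_subst_ne_zero {L ϑ : E⟦X⟧} (hϑ0 : constantCoeff ϑ = 0) (hL : constantCoeff L ≠ 0) :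
    constantCoeff (L.subst ϑ) ≠ 0 := by
  rwa [constantCoeff_subst_of_constantCoeff_eq_zero hϑ0]

/-- ★ `D_F (log̃ g) = δ g − (π′/p)·(δ^φ g^φ)∘f` — the relative tilde of the logarithmic derivative, formally. -/
theorem invDeriv_logTilde (φ : E →+* E) {lam f g : E⟦X⟧} (hf0 : constantCoeff f = 0) (hg0 : constantCoeff g = 1)
    (hlam : constantCoeff (d⁄dX E lam) ≠ 0) (hlamφ : constantCoeff (d⁄dX E (lam.map φ)) ≠ 0)
    {π' p : E} (hfe : (d⁄dX E (lam.map φ)).subst f * d⁄dX E f = C π' * d⁄dX E lam) :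
    d⁄dX E (logOf g - C p⁻¹ * (logOf (g.map φ)).subst f) * (d⁄dX E lam)⁻¹
      = d⁄dX E g * g⁻¹ * (d⁄dX E lam)⁻¹
        - C (π' / p) * (d⁄dX E (g.map φ) * (g.map φ)⁻¹ * (d⁄dX E (lam.map φ))⁻¹).subst f := by
  have hs : HasSubst f := HasSubst.of_constantCoeff_zero' hf0
  have hgφ0 : constantCoeff (g.map φ) = 1 := by
    rw [← coeff_zero_eq_constantCoeff_apply, coeff_map, coeff_zero_eq_constantCoeff_apply, hg0, map_one]
  have h1 : d⁄dX E (logOf g) = d⁄dX E g * g⁻¹ := derivative_logOf_eq hg0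
  have h2 : d⁄dX E (logOf (g.map φ)) = d⁄dX E (g.map φ) * (g.map φ)⁻¹ := derivative_logOf_eq hgφ0
  have h3 : d⁄dX E (C p⁻¹ * (logOf (g.map φ)).subst f)
      = C p⁻¹ * ((d⁄dX E (g.map φ) * (g.map φ)⁻¹).subst f * d⁄dX E f) := by
    rw [← smul_eq_C_mul, Derivation.map_smul, derivative_subst E hs, smul_eq_C_mul, h2]
  have hM0 : constantCoeff ((d⁄dX E (lam.map φ)).subst f) ≠ 0 := constantCoeff_subst_ne_zero hf0 hlamφ
  have hL : d⁄dX E lam * (d⁄dX E lam)⁻¹ = 1 := PowerSeries.mul_inv_cancel _ hlam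
  have hM : (d⁄dX E (lam.map φ)).subst f * ((d⁄dX E (lam.map φ)).subst f)⁻¹ = 1 :=
    PowerSeries.mul_inv_cancel _ hM0
  rw [map_sub, h1, h3, show C (π' / p) = C π' * C p⁻¹ by rw [div_eq_mul_inv, map_mul]]
  simp only [subst_mul hs]
  rw [subst_inv_of_constantCoeff_ne_zero hf0 hlamφ]
  linear_combination
    (-(C p⁻¹ * ((d⁄dX E (g.map φ)).subst f * ((g.map φ)⁻¹).subst f) * C π'
        * ((d⁄dX E (lam.map φ)).subst f)⁻¹)) * hL
    + (C p⁻¹ * ((d⁄dX E (g.map φ)).subst f * ((g.map φ)⁻¹).subst f) * d⁄dX E f * (d⁄dX E lam)⁻¹) * hM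
    + (-(C p⁻¹ * ((d⁄dX E (g.map φ)).subst f * ((g.map φ)⁻¹).subst f) * (d⁄dX E lam)⁻¹
        * ((d⁄dX E (lam.map φ)).subst f)⁻¹)) * hfe

/-- `δ` commutes with the coefficient map: `(h′·h⁻¹·(λ′)⁻¹).map φ = (h^φ)′·(h^φ)⁻¹·((λ^φ)′)⁻¹` — so the second term of
`invDeriv_logTilde` IS `(π′/p)·((δ g)^φ)∘f`, the tree's relative tilde shape `h − C u · subst f (map φ h)`. -/
theorem map_derivative (φ : E →+* E) (g : E⟦X⟧) : (d⁄dX E g).map φ = d⁄dX E (g.map φ) := by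
  ext n
  simp [coeff_map, coeff_derivative]

theorem map_inv_of_constantCoeff_ne_zero (φ : E →+* E) {h : E⟦X⟧} (hh : constantCoeff h ≠ 0) :
    (h⁻¹).map φ = (h.map φ)⁻¹ := by
  have hh' : constantCoeff (h.map φ) ≠ 0 := by
    rw [← coeff_zero_eq_constantCoeff_apply, coeff_map, coeff_zero_eq_constantCoeff_apply]
    exact (map_ne_zero φ).mpr hh
  have hmul : (h⁻¹).map φ * h.map φ = 1 := by
    rw [← map_mul, PowerSeries.inv_mul_cancel _ hh, map_one]
  have := (eq_mul_inv_iff_mul_eq hh').mpr hmul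
  rwa [one_mul] at this

theorem map_delta (φ : E →+* E) {lam g : E⟦X⟧} (hg0 : constantCoeff g ≠ 0) (hlam : constantCoeff (d⁄dX E lam) ≠ 0) :
    (d⁄dX E g * g⁻¹ * (d⁄dX E lam)⁻¹).map φ
      = d⁄dX E (g.map φ) * (g.map φ)⁻¹ * (d⁄dX E (lam.map φ))⁻¹ := by
  rw [map_mul, map_mul, map_inv_of_constantCoeff_ne_zero φ hg0, map_inv_of_constantCoeff_ne_zero φ hlam,
    map_derivative, map_derivative]

end RelativeTilde

end Summit.BirchSwinnertonDyer.BirchSwinnertonDyer.Cruxes.SplitBadTwoLowerHalfOfFacts.PrimTwoK1G37
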